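import Summits.BirchSwinnertonDyer.BirchSwinnertonDyer.Theorems.GenusKolyvaginAtTwoGenusPrimitiveSupplyAtTwoOfKernelsClosed
import Summits.BirchSwinnertonDyer.BirchSwinnertonDyer.Theorems.GenusKolyvaginAtTwoGenusPrimitiveSupplyAtTwoTwinSupplyDuality
import HarnessLib
import Summits.BirchSwinnertonDyer.BirchSwinnertonDyer.Theorems.GenusKolyvaginAtTwoGenusPrimitiveSupplyAtTwoTwinSupplyDualityEll

/-!
# Route `GenusKolyvaginAtTwo`, crux #2 `GenusPrimitiveSupplyAtTwo` (stmt-BirchSwinnertonDyer-22136):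
# THE CRUX BY NAME with Mazur–Rubin Prop. 5.2 DISCHARGED — modulo {Modularity, 2-parity, Cassels–Tate, Poitou–Tate, Tate χ,
# Gross–Zagier} (all print, by name) ∧ (CONV₂) ∧ (U)

Lead seat `bsd-line-gk2-p1` g8 (cell `bsd-f1-sign2`). THEOREMS ONLY (no definition, no named fact, no `sorry`); helper
`--supports stmt-BirchSwinnertonDyer-22136` (conditional-result); no item is closed; BSD is not proved by any of this.

The lead's g2/g3 closers (`GenusKoly.genusPrimitiveSupplyAtTwo_of_twoConverse_of_multiGenus`, p592691/p593673, and the re-typed glue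
`genusPrimitiveSupplyAtTwo_of_split[']`, `…OfKernelsClosed`) conclude the crux BY NAME from five named print facts — among them
`MazurRubin2010.prop52_rat` — plus the line's two open kernels (CONV₂) and (U). With the companion files of this gen
(`…LoweringPrime`, `…TwistSelmerTransferDownTwo`, `…LoweringStep`, `…TwinSupplyDuality`) Prop. 5.2 is a kernel theorem on the
habitat modulo the two standard duality facts; this file records the crux closers in that currency:

* `genusPrimitiveSupplyAtTwo_of_duality_of_twoConverse_of_multiGenus` — the g2 closer with `hMR` replaced by
  `hPT : poitouTate_selmerStructure_duality_real ℚ`, `hEP : ∀ v, localEulerPoincareCharacteristic ℚ_v` (proof verbatim, stub A via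
  `GenusKolyLowering.stub_minimalTwinSupplyAtTwo_of_duality_of_twoConverse`);
* `genusPrimitiveSupplyAtTwo_of_kernels_of_duality` — in the vocabulary of the route items: `MultiGenusPrimitivityAtTwo →
  RankOneTwoConverse → RankOneTwoConverseOffSemistableAtTwo → ModularityExistsNewform → TwoParityDD → CasselsTatePairingRat →
  GrossZagierAllLevels → poitouTate_selmerStructure_duality_real ℚ → (∀ v, localEulerPoincareCharacteristic ℚ_v) →
  GenusPrimitiveSupplyAtTwo` — the corrected glue (`genusPrimitiveSupplyAtTwo_of_split'`) with the item `MazurRubinProp52Rat` (24950)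
  TRADED for the two standard duality facts. If the pen re-types glue 24951 in this shape its closer is `exact` this theorem.

Honest framing: the crux is OPEN exactly at (CONV₂) ∧ (U) (lineage verdict g4–g7: U = odd-twist `2`-primitivity = W. Zhang's base
case at `p = 2`); this file changes only the PRINT side of the cone. BSD is not proved by any of this.

References: [MazurRubin2010] Prop. 5.2, Lemma 3.6, Cor. 3.4 (i); [GrossZagier1986] Thm. I.6.3; [DokchitserDokchitserAnnals2010] Thm. 1.4;
[GrossLMS1991] §3 (3.5), §4 (4.1); [MilneADT2006] I Thm. 4.10; [McCallumLMS1991] §5 Lemma 5.1.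
-/

set_option linter.dupNamespace false -- tree convention: `Summit.BirchSwinnertonDyer.BirchSwinnertonDyer.Theorems` (summit = sub-problem)

noncomputable section

open scoped Classical

namespace Summit.BirchSwinnertonDyer.BirchSwinnertonDyer.Theorems.GenusKolyLowering

open Finset NumberField WeierstrassCurve IsDedekindDomain Literature.NumberTheory.EllipticCurves
  Literature.NumberTheory.EllipticCurves.ModularForms Literature.NumberTheory.GaloisRepresentations
  Literature.NumberTheory.GaloisCohomology
open Summit.BirchSwinnertonDyer.BirchSwinnertonDyer.Theorems.GenusKoly
open Summit.BirchSwinnertonDyer.BirchSwinnertonDyer.Theses.GenusKolyvaginAtTwo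

/-- **THE CRUX `GenusPrimitiveSupplyAtTwo` BY NAME, Mazur–Rubin Prop. 5.2 DISCHARGED: modulo Modularity ∧ `2`-parity ∧
Cassels–Tate ∧ Poitou–Tate ∧ Tate χ ∧ Gross–Zagier (print, displayed) ∧ (CONV₂) ∧ (U).** The g2 closer
`GenusKoly.genusPrimitiveSupplyAtTwo_of_twoConverse_of_multiGenus` VERBATIM with stub A supplied by
`stub_minimalTwinSupplyAtTwo_of_duality_of_twoConverse` (the lowering step `hMR` is now the kernel theorem
`prop52_of_hasSurjectiveModNGaloisRep`). (CONV₂) = the rank-one `2`-converse for non-CM curves (crux 19220, widened off its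
reduction clause); (U) = multi-genus `2`-primitivity on the habitat (crux 24947's statement verbatim). CONDITIONAL; crux 22136 is
OPEN exactly at (CONV₂) ∧ (U). BSD is not proved by any of this. [cite: MazurRubin2010, Prop. 5.2 (proof) with Lemma 3.6]
[cite: GrossZagier1986, Thm. I.6.3] [cite: DokchitserDokchitserAnnals2010, Thm. 1.4] [cite: GrossLMS1991, §3 (3.5), §4 (4.1)]
[cite: MilneADT2006, Ch. I, Thm. 4.10] -/
theorem genusPrimitiveSupplyAtTwo_of_duality_of_twoConverse_of_multiGenus (hmod : exists_isNewformOf)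
    (hpar : ∀ V : WeierstrassCurve ℚ, p_parity V 2) (hCT : exists_casselsTate_pairing (K := ℚ))
    (hPT : poitouTate_selmerStructure_duality_real ℚ)
    (hEP : ∀ v : HeightOneSpectrum (𝓞 ℚ), localEulerPoincareCharacteristic (v.adicCompletion ℚ))
    (hGZ : ∀ (W : WeierstrassCurve ℚ) [NeZero (W.conductorNorm ℤ)] (K : Type) [Field K] [NumberField K],
      gross_zagier (W.conductorNorm ℤ) W K)
    (hconv : ∀ (V : WeierstrassCurve ℚ) [V.IsElliptic] [V.IsGloballyMinimal],
      ¬ V.HasCM → V.selmerCorank 2 = 1 → V.analyticRank = 1)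
    (hU : ∀ (W : WeierstrassCurve ℚ) [W.IsElliptic] [W.IsGloballyMinimal] [NeZero (W.conductorNorm ℤ)],
      ¬ W.HasCM → W.analyticRank = 0 → (∀ n : ℕ, 0 < n → W.HasSurjectiveModNGaloisRep ((2 : ℤ) ^ n)) →
      Odd W.tamagawaProduct →
      ∀ (K : Type) [Field K] [NumberField K],
      IsImaginaryQuadratic K → Odd (NumberField.discr K) → NumberField.discr K ≠ -3 →
      SatisfiesHeegnerHypothesis (W.conductorNorm ℤ) K →
      ¬ IsSquare ((NumberField.discr K : ℚ) * -|W.Δ|) → ¬ IsSquare ((NumberField.discr K : ℚ) * (-(2 * |W.Δ|))) →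
      ∀ (Dt : ModularParametrizationData W (W.conductorNorm ℤ)),
      (∀ z ∈ Dt.L.lattice, ∃ w ∈ periodLattice Dt.f, z = (Dt.c : ℂ) * w) → Odd Dt.c →
      ∀ (β : ℤ) (ι : K →+* ℂ) (d₁ : KolyvaginHeegnerData Dt β ι 1), ¬ IsOfFinAddOrder d₁.derivedPoint →
      ∀ (Wd : WeierstrassCurve ℚ) [Wd.IsElliptic] [Wd.IsGloballyMinimal],
      (∃ C : WeierstrassCurve.VariableChange ℚ, C • W.quadraticTwist (NumberField.discr K : ℚ) = Wd) →
      Wd.analyticRank = 1 → Nat.card (Wd.selmerGroup 2) = 2 →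
      ∃ (n : ℕ) (d : KolyvaginHeegnerData Dt β ι n) (θ : ℕ → ringClassField K ι n)
        (T : Finset (ringClassField K ι n ≃ₐ[ℚ] ringClassField K ι n)), Squarefree n ∧
        (∀ ℓ ∈ n.primeFactors, Zhang2014.IsKolyvaginPrime (W.conductorNorm ℤ) W K 2 ℓ) ∧
        (∀ ℓ ∈ n.primeFactors, θ ℓ ^ 2 = algebraMap ℚ (ringClassField K ι n) ((-1 : ℚ) ^ (ℓ / 2) * ℓ)) ∧
        (∀ g, g ∈ T ↔ g ∈ ringClassGal ι n ∧ ∀ ℓ ∈ n.primeFactors, g (θ ℓ) = θ ℓ) ∧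
        ¬ ∃ Q : (W.baseChange (ringClassField K ι n)).toAffine.Point, (2 : ℤ) • Q =
          ∑ g ∈ T, pointGalHom W (ringClassField K ι n) g d.y) :
    GenusPrimitiveSupplyAtTwo := by
  intro W _ _ _ hcm hr0 hρ hT hopt
  -- A = Prop. 5.2 (kernel) SUPPLY + CONV₂
  obtain ⟨K, iF, iN, hIQ, hodd, h3, hHe, hsq1, hsq2, Wd, iE, iM, hWd, hrd, hSel⟩ :=
    stub_minimalTwinSupplyAtTwo_of_duality_of_twoConverse hmod hpar hCT hPT hEP hconv W hcm hr0 hρ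
  obtain ⟨Dt, hoptDt, hc⟩ := hopt
  obtain ⟨β, hβ⟩ : ∃ β : ℤ, (4 * (W.conductorNorm ℤ : ℕ) : ℤ) ∣ β ^ 2 - NumberField.discr K :=
    Literature.NumberTheory.QuadraticFields.Quadratic.exists_dvd_sq_sub_discr_of_ncard_primesOver hIQ.1 (NeZero.ne _) hHe
  obtain ⟨ι⟩ : Nonempty (K →+* ℂ) := inferInstance
  obtain ⟨d₁⟩ := exists_kolyvaginHeegnerData_one
    (phi_heegnerTau_mem_singularModuliField_holds (W.conductorNorm ℤ) W K) hIQ Dt β ι hβ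
  have hd : (NumberField.discr K : ℚ) ≠ 0 := by exact_mod_cast NumberField.discr_ne_zero K
  haveI := W.isElliptic_quadraticTwist hd
  have hcmd : ¬ Wd.HasCM := twin_not_hasCM W hcm hd Wd hWd
  have hrtw : (W.quadraticTwist (NumberField.discr K : ℚ)).analyticRank = 1 := by
    obtain ⟨C, hC⟩ := hWd
    rw [← analyticRank_smul (W.quadraticTwist (NumberField.discr K : ℚ)) C, hC]
    exact hrd
  -- B = Gross–Zagier alone
  have hy : ¬ IsOfFinAddOrder d₁.derivedPoint := stub_heegnerNonTorsionAtTwo_of_grossZagier hGZ W K hIQ hHe hr0 hrtw Dt β ι d₁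
  obtain ⟨M₀, hdiv, hndiv⟩ := exists_exactTwoDivisibility_of_not_isOfFinAddOrder W hIQ Dt β ι d₁ hy
  -- C = U through the intrinsic dictionary
  obtain ⟨n, d, hn, hKoly, hPn⟩ := exists_derivedPoint_not_two_dvd_of_multiGenusTrace hIQ hodd h3 hHe
    (hU W hcm hr0 hρ hT K hIQ hodd h3 hHe hsq1 hsq2 Dt hoptDt hc β ι d₁ hy Wd hWd hrd hSel)
  exact ⟨K, iF, iN, hIQ, hodd, h3, hHe, hsq1, hsq2, Dt, β, ι, d₁, hoptDt, hc, hy, M₀, hdiv, hndiv, n, d, hn, hKoly, hPn,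
    Wd, iE, iM, hWd, hcmd, hrd, hSel⟩

/-! ## R-128 retype (director-bsd 2026-08-29 17:42Z, T-Q381-1′; seat bsd-line-gk2-p2 g21): PRINT-FORM TWINS
Every theorem below is the byte-identical twin of the theorem of the same name without the trailing prime, with the ONE change
that the `2`-parity hypothesis is typed as print has it — `∀ (V : WeierstrassCurve ℚ) [V.IsElliptic], p_parity V 2`
(Dokchitser–Dokchitser 2010 Thm. 1.4, elliptic curves; = route item `TwoParityDD` after rev 34) — instead of the bare closure
`∀ V : WeierstrassCurve ℚ, p_parity V 2` over all Weierstrass cubics (singular ones included: off print, undischargeable).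
Calls to other retyped theorems go to their primed twins; every application `hpar W` is at an elliptic curve, so the proofs are
unchanged. The unprimed originals are kept (append-only tree) and are superseded by these. BSD is NOT proved by any of this. -/

/-- **R-128 retype** (director-bsd 2026-08-29, T-Q381-1′) of `genusPrimitiveSupplyAtTwo_of_duality_of_twoConverse_of_multiGenus`: the SAME statement and proof with the `2`-parity hypothesis in PRINT form `∀ (V : WeierstrassCurve ℚ) [V.IsElliptic], p_parity V 2` (Dokchitser–Dokchitser 2010 Thm. 1.4 is about elliptic curves; the bare closure over all Weierstrass cubics was off print). **THE CRUX `GenusPrimitiveSupplyAtTwo` BY NAME, Mazur–Rubin Prop. 5.2 DISCHARGED: modulo Modularity ∧ `2`-parity ∧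
Cassels–Tate ∧ Poitou–Tate ∧ Tate χ ∧ Gross–Zagier (print, displayed) ∧ (CONV₂) ∧ (U).** The g2 closer
`GenusKoly.genusPrimitiveSupplyAtTwo_of_twoConverse_of_multiGenus'` VERBATIM with stub A supplied by
`stub_minimalTwinSupplyAtTwo_of_duality_of_twoConverse'` (the lowering step `hMR` is now the kernel theorem
`prop52_of_hasSurjectiveModNGaloisRep`). (CONV₂) = the rank-one `2`-converse for non-CM curves (crux 19220, widened off its
reduction clause); (U) = multi-genus `2`-primitivity on the habitat (crux 24947's statement verbatim). CONDITIONAL; crux 22136 is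
OPEN exactly at (CONV₂) ∧ (U). BSD is not proved by any of this. [cite: MazurRubin2010, Prop. 5.2 (proof) with Lemma 3.6]
[cite: GrossZagier1986, Thm. I.6.3] [cite: DokchitserDokchitserAnnals2010, Thm. 1.4] [cite: GrossLMS1991, §3 (3.5), §4 (4.1)]
[cite: MilneADT2006, Ch. I, Thm. 4.10] -/
theorem genusPrimitiveSupplyAtTwo_of_duality_of_twoConverse_of_multiGenus' (hmod : exists_isNewformOf)
    (hpar : ∀ (V : WeierstrassCurve ℚ) [V.IsElliptic], p_parity V 2) (hCT : exists_casselsTate_pairing (K := ℚ))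
    (hPT : poitouTate_selmerStructure_duality_real ℚ)
    (hEP : ∀ v : HeightOneSpectrum (𝓞 ℚ), localEulerPoincareCharacteristic (v.adicCompletion ℚ))
    (hGZ : ∀ (W : WeierstrassCurve ℚ) [NeZero (W.conductorNorm ℤ)] (K : Type) [Field K] [NumberField K],
      gross_zagier (W.conductorNorm ℤ) W K)
    (hconv : ∀ (V : WeierstrassCurve ℚ) [V.IsElliptic] [V.IsGloballyMinimal],
      ¬ V.HasCM → V.selmerCorank 2 = 1 → V.analyticRank = 1)
    (hU : ∀ (W : WeierstrassCurve ℚ) [W.IsElliptic] [W.IsGloballyMinimal] [NeZero (W.conductorNorm ℤ)],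
      ¬ W.HasCM → W.analyticRank = 0 → (∀ n : ℕ, 0 < n → W.HasSurjectiveModNGaloisRep ((2 : ℤ) ^ n)) →
      Odd W.tamagawaProduct →
      ∀ (K : Type) [Field K] [NumberField K],
      IsImaginaryQuadratic K → Odd (NumberField.discr K) → NumberField.discr K ≠ -3 →
      SatisfiesHeegnerHypothesis (W.conductorNorm ℤ) K →
      ¬ IsSquare ((NumberField.discr K : ℚ) * -|W.Δ|) → ¬ IsSquare ((NumberField.discr K : ℚ) * (-(2 * |W.Δ|))) →
      ∀ (Dt : ModularParametrizationData W (W.conductorNorm ℤ)),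
      (∀ z ∈ Dt.L.lattice, ∃ w ∈ periodLattice Dt.f, z = (Dt.c : ℂ) * w) → Odd Dt.c →
      ∀ (β : ℤ) (ι : K →+* ℂ) (d₁ : KolyvaginHeegnerData Dt β ι 1), ¬ IsOfFinAddOrder d₁.derivedPoint →
      ∀ (Wd : WeierstrassCurve ℚ) [Wd.IsElliptic] [Wd.IsGloballyMinimal],
      (∃ C : WeierstrassCurve.VariableChange ℚ, C • W.quadraticTwist (NumberField.discr K : ℚ) = Wd) →
      Wd.analyticRank = 1 → Nat.card (Wd.selmerGroup 2) = 2 →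
      ∃ (n : ℕ) (d : KolyvaginHeegnerData Dt β ι n) (θ : ℕ → ringClassField K ι n)
        (T : Finset (ringClassField K ι n ≃ₐ[ℚ] ringClassField K ι n)), Squarefree n ∧
        (∀ ℓ ∈ n.primeFactors, Zhang2014.IsKolyvaginPrime (W.conductorNorm ℤ) W K 2 ℓ) ∧
        (∀ ℓ ∈ n.primeFactors, θ ℓ ^ 2 = algebraMap ℚ (ringClassField K ι n) ((-1 : ℚ) ^ (ℓ / 2) * ℓ)) ∧
        (∀ g, g ∈ T ↔ g ∈ ringClassGal ι n ∧ ∀ ℓ ∈ n.primeFactors, g (θ ℓ) = θ ℓ) ∧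
        ¬ ∃ Q : (W.baseChange (ringClassField K ι n)).toAffine.Point, (2 : ℤ) • Q =
          ∑ g ∈ T, pointGalHom W (ringClassField K ι n) g d.y) :
    GenusPrimitiveSupplyAtTwo := by
  intro W _ _ _ hcm hr0 hρ hT hopt
  -- A = Prop. 5.2 (kernel) SUPPLY + CONV₂
  obtain ⟨K, iF, iN, hIQ, hodd, h3, hHe, hsq1, hsq2, Wd, iE, iM, hWd, hrd, hSel⟩ :=
    stub_minimalTwinSupplyAtTwo_of_duality_of_twoConverse' hmod hpar hCT hPT hEP hconv W hcm hr0 hρ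
  obtain ⟨Dt, hoptDt, hc⟩ := hopt
  obtain ⟨β, hβ⟩ : ∃ β : ℤ, (4 * (W.conductorNorm ℤ : ℕ) : ℤ) ∣ β ^ 2 - NumberField.discr K :=
    Literature.NumberTheory.QuadraticFields.Quadratic.exists_dvd_sq_sub_discr_of_ncard_primesOver hIQ.1 (NeZero.ne _) hHe
  obtain ⟨ι⟩ : Nonempty (K →+* ℂ) := inferInstance
  obtain ⟨d₁⟩ := exists_kolyvaginHeegnerData_one
    (phi_heegnerTau_mem_singularModuliField_holds (W.conductorNorm ℤ) W K) hIQ Dt β ι hβ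
  have hd : (NumberField.discr K : ℚ) ≠ 0 := by exact_mod_cast NumberField.discr_ne_zero K
  haveI := W.isElliptic_quadraticTwist hd
  have hcmd : ¬ Wd.HasCM := twin_not_hasCM W hcm hd Wd hWd
  have hrtw : (W.quadraticTwist (NumberField.discr K : ℚ)).analyticRank = 1 := by
    obtain ⟨C, hC⟩ := hWd
    rw [← analyticRank_smul (W.quadraticTwist (NumberField.discr K : ℚ)) C, hC]
    exact hrd
  -- B = Gross–Zagier alone
  have hy : ¬ IsOfFinAddOrder d₁.derivedPoint := stub_heegnerNonTorsionAtTwo_of_grossZagier hGZ W K hIQ hHe hr0 hrtw Dt β ι d₁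
  obtain ⟨M₀, hdiv, hndiv⟩ := exists_exactTwoDivisibility_of_not_isOfFinAddOrder W hIQ Dt β ι d₁ hy
  -- C = U through the intrinsic dictionary
  obtain ⟨n, d, hn, hKoly, hPn⟩ := exists_derivedPoint_not_two_dvd_of_multiGenusTrace hIQ hodd h3 hHe
    (hU W hcm hr0 hρ hT K hIQ hodd h3 hHe hsq1 hsq2 Dt hoptDt hc β ι d₁ hy Wd hWd hrd hSel)
  exact ⟨K, iF, iN, hIQ, hodd, h3, hHe, hsq1, hsq2, Dt, β, ι, d₁, hoptDt, hc, hy, M₀, hdiv, hndiv, n, d, hn, hKoly, hPn,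
    Wd, iE, iM, hWd, hcmd, hrd, hSel⟩

/-- **The corrected glue with `MazurRubinProp52Rat` TRADED for {Poitou–Tate, Tate χ}** (route-item vocabulary):
`MultiGenusPrimitivityAtTwo → RankOneTwoConverse → RankOneTwoConverseOffSemistableAtTwo → ModularityExistsNewform → TwoParityDD →
CasselsTatePairingRat → GrossZagierAllLevels → poitouTate_selmerStructure_duality_real ℚ → (∀ v, localEulerPoincareCharacteristic ℚ_v) →
GenusPrimitiveSupplyAtTwo`, proved outright (compare `GenusKoly.genusPrimitiveSupplyAtTwo_of_split'`, which has `MazurRubinProp52Rat`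
where this has the two duality facts). CONDITIONAL on its antecedents; the non-print ones are the items 24947 (U), 19220, 24948 (CONV₂).
BSD is not proved by any of this. [cite: MazurRubin2010, Prop. 5.2] [cite: GrossZagier1986, Thm. I.6.3] [cite: MilneADT2006, Ch. I, Thm. 4.10] -/
theorem genusPrimitiveSupplyAtTwo_of_kernels_of_duality :
    MultiGenusPrimitivityAtTwo → RankOneTwoConverse → RankOneTwoConverseOffSemistableAtTwo → ModularityExistsNewform → TwoParityDD →
      CasselsTatePairingRat → GrossZagierAllLevels → poitouTate_selmerStructure_duality_real ℚ →
      (∀ v : HeightOneSpectrum (𝓞 ℚ), localEulerPoincareCharacteristic (v.adicCompletion ℚ)) → GenusPrimitiveSupplyAtTwo :=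
  fun hU h1 h2 hmod hpar hCT hGZ hPT hEP ↦
    genusPrimitiveSupplyAtTwo_of_duality_of_twoConverse_of_multiGenus' hmod hpar hCT hPT hEP (fun W _ K _ _ ↦ hGZ _ W K)
      (twoConverse_of_split h1 h2) hU


end Summit.BirchSwinnertonDyer.BirchSwinnertonDyer.Theorems.GenusKolyLowering

end
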